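import Mathlib
import Summits.Ventures.LatticeQCDFlow.TrivializingMaps.WitnessNearestNeighbour
import Summits.Ventures.LatticeQCDFlow.TrivializingMaps.WitnessColumnLinkRP
import Summits.Ventures.LatticeQCDFlow.TrivializingMaps.WitnessColumnPlaquette
import Summits.Ventures.LatticeQCDFlow.TrivializingMaps.WitnessVarianceFloor
import HarnessLib

/-!
# THEOREM P docked: the plaquette column lies above a strictly positive ray, hypothesis-free

HONEST FRAMING: exact (Metropolis-corrected) sampling algorithms for lattice gauge theory; figures of
merit are autocorrelation/cost numbers at stated couplings and volumes; no continuum-physics claim.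

The dock of THEOREM P (`WitnessNearestNeighbour`: `c₁ = K_p(1) > 0`) and THEOREM V
(`WitnessVarianceFloor`: `v = K_p(0) > 0`) to THEOREM W′ (`WitnessColumnLinkRP`: the one-step envelope
`v (c₁/v)ᵗ ≤ K(t)` for `t ≤ L` under `hv : 0 < v`, `hc : 0 < c₁`, and its footprint corollary).
Lattice `SU(n)`, defining representation, `n ≥ 2`, every `β > 0`, every EVEN `L`, every `d ≥ 2`,
every spatial plaquette `p = (x; i, j)` of the slice `x₀ = 0` (`0 < i < j`), `K(t) = K_p(t) :=
sliceCov (defRep n) β (Re tr U_p) t = Cov_β(Re tr U_p, Re tr U_{p+t e₀})`: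
* `plaqRe_column_geometric_lower`: `K(0) · (K(1)/K(0))ᵗ ≤ K(t)` for every `t ≤ L` — NO hypothesis on
  the column (both inputs of THEOREM W′ (e) are now theorems);
* `plaqRe_sliceCov_pos`: consequently `0 < K(t)` for EVERY `t : ZMod L` — the plaquette–plaquette
  column of a positive-coupling lattice `SU(n)` theory on an even torus is strictly positive at every
  time separation (even separations were `≥ 0` by site RP, odd ones by link RP; strictness is new);
* `Gauge.sep_le_two_mul_range_of_plaquette_one`: THEOREM W′ (f), the footprint floor `sep ≤ 2r` for a
  local proposal of mean acceptance `acc` with `4 (1 - acc) n² < K(0) (K(1)/K(0))ᵗ`, with `hv` and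
  `hc` DISCHARGED — what remains are the sampler's data (`dist`, `Φ`, `q`, `r`, `acc`) and the
  separation `t`.

NOT CLAIMED: a useful SIZE for `K(1)/K(0)` (THEOREM P's constant carries `e^{-3βn#plaq}`); `β ≤ 0`
(at `β = 0` the column vanishes for `t ≠ 0`); odd `L`; `d = 1` (no spatial plaquette).

References: as in `WitnessNearestNeighbour`, `WitnessColumnLinkRP`.
-/

noncomputable section

namespace Summit.Ventures.LatticeQCDFlow.TrivializingMaps

open MeasureTheory
open scoped ComplexOrder

namespace WitnessColumn

open Literature.MathematicalPhysics.QuantumFieldTheory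

section SUn

open Matrix

variable {d L n : ℕ} [NeZero d] [NeZero L]

/-- **The column above a strictly positive ray, hypothesis-free** (lattice `SU(n)`, `n ≥ 2`, `β > 0`,
`L` even, spatial slice-`0` plaquette `p`): `K(0) · (K(1)/K(0))ᵗ ≤ K(t)` for every `t ≤ L`
(THEOREM W′ (e) with `hv` from THEOREM V and `hc` from THEOREM P). -/
theorem plaqRe_column_geometric_lower (hL : Even L) (hn : 2 ≤ n) {β : ℝ} (hβ : 0 < β)
    (p : Plaquette d L) (h0 : p.1 0 = 0) (hi : 0 < p.2.1.1) {t : ℕ} (ht : t ≤ L) :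
    sliceCov (StrongCoupling.defRep n) β (fun U : GaugeConfig d L (specialUnitaryGroup (Fin n) ℂ) =>
        WilsonRP.plaqRe (StrongCoupling.defRep n) U p) 0
      * (sliceCov (StrongCoupling.defRep n) β (fun U : GaugeConfig d L (specialUnitaryGroup (Fin n) ℂ) =>
            WilsonRP.plaqRe (StrongCoupling.defRep n) U p) 1
          / sliceCov (StrongCoupling.defRep n) β
              (fun U : GaugeConfig d L (specialUnitaryGroup (Fin n) ℂ) =>
                WilsonRP.plaqRe (StrongCoupling.defRep n) U p) 0) ^ t
      ≤ sliceCov (StrongCoupling.defRep n) β (fun U : GaugeConfig d L (specialUnitaryGroup (Fin n) ℂ) =>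
          WilsonRP.plaqRe (StrongCoupling.defRep n) U p) (t : ZMod L) := by
  have h2L : 2 ≤ L := by obtain ⟨r, hr⟩ := hL; have := NeZero.ne L; omega
  have hρ : Continuous (StrongCoupling.defRep n) := continuous_subtype_val
  have hv : 0 < sliceCov (StrongCoupling.defRep n) β
      (fun U : GaugeConfig d L (specialUnitaryGroup (Fin n) ℂ) =>
        WilsonRP.plaqRe (StrongCoupling.defRep n) U p) 0 := by
    rw [sliceCov_zero]
    exact plaqRe_variance_pos h2L hn β p
  exact sliceCov_geometric_lower_one (StrongCoupling.defRep n) hL hρ hβ.le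
    (WilsonRP.measurable_plaqRe _ hρ p) (fun U => WilsonRP.abs_plaqRe_le _ hρ U p)
    (dependsOn_plaqRe_slice _ h0 hi.ne' (hi.trans p.2.2).ne')
    hv (plaqRe_sliceCov_one_pos hL hn hβ p h0 hi) ht

/-- **The whole plaquette column is strictly positive** (lattice `SU(n)`, `n ≥ 2`, `β > 0`, `L` even,
spatial slice-`0` plaquette `p`): `0 < K(t) = Cov_β(Re tr U_p, Re tr U_{p + t e₀})` for EVERY
`t : ZMod L`. -/
theorem plaqRe_sliceCov_pos (hL : Even L) (hn : 2 ≤ n) {β : ℝ} (hβ : 0 < β) (p : Plaquette d L)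
    (h0 : p.1 0 = 0) (hi : 0 < p.2.1.1) (t : ZMod L) :
    0 < sliceCov (StrongCoupling.defRep n) β (fun U : GaugeConfig d L (specialUnitaryGroup (Fin n) ℂ) =>
      WilsonRP.plaqRe (StrongCoupling.defRep n) U p) t := by
  have h2L : 2 ≤ L := by obtain ⟨r, hr⟩ := hL; have := NeZero.ne L; omega
  have hv : 0 < sliceCov (StrongCoupling.defRep n) β
      (fun U : GaugeConfig d L (specialUnitaryGroup (Fin n) ℂ) =>
        WilsonRP.plaqRe (StrongCoupling.defRep n) U p) 0 := by
    rw [sliceCov_zero]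
    exact plaqRe_variance_pos h2L hn β p
  have hc := plaqRe_sliceCov_one_pos (d := d) hL hn hβ p h0 hi
  have h := plaqRe_column_geometric_lower hL hn hβ p h0 hi (ZMod.val_lt t).le
  rw [ZMod.natCast_zmod_val] at h
  exact lt_of_lt_of_le (mul_pos hv (pow_pos (div_pos hc hv) _)) h

end SUn

/-! ## The footprint floor with `hv`, `hc` discharged -/

namespace Gauge

open Literature.MathematicalPhysics.QuantumFieldTheory.Luscher2010

variable {d L n : ℕ} [NeZero d] [NeZero L]

/-- **THEOREM W′ (f) for the plaquette at separation `t`, hypothesis-free in the column** (lattice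
`SU(n)`, `n ≥ 2`, `β > 0`, `L` even): `π = wilsonMeasure (defRep n) β`, a proposal law `Φ_* ν` of
density `q` whose link maps read only links within `dist`-distance `r`, mean MH acceptance `≥ acc`;
`p` a spatial plaquette of the slice `x₀ = 0`. If the slices `0` and `t` (`t ≤ L`) are
`sep`-separated and `4 (1 - acc) n² < K(0) (K(1)/K(0))ᵗ` then `sep ≤ 2 r`. The inputs `K(0) > 0`,
`K(1) > 0` of `sep_le_two_mul_range_of_sliceCov_one` are THEOREMS V and P. -/
theorem sep_le_two_mul_range_of_plaquette_one (hL : Even L) (hn : 2 ≤ n) {β : ℝ} (hβ : 0 < β)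
    (dist : Edge d L → Edge d L → ℕ) (hsymm : ∀ e e', dist e e' = dist e' e)
    (htri : ∀ e e' e'', dist e e'' ≤ dist e e' + dist e' e'')
    {Φ : GaugeConfig d L (Matrix.specialUnitaryGroup (Fin n) ℂ) →
      GaugeConfig d L (Matrix.specialUnitaryGroup (Fin n) ℂ)} (hΦm : Measurable Φ)
    {q : GaugeConfig d L (Matrix.specialUnitaryGroup (Fin n) ℂ) → ℝ} (hq0 : ∀ U, 0 ≤ q U)
    (hqm : Measurable q)
    (hν : (trivialMeasure (Matrix.specialUnitaryGroup (Fin n) ℂ) d L).map Φ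
      = (trivialMeasure (Matrix.specialUnitaryGroup (Fin n) ℂ) d L).withDensity
          fun U => ENNReal.ofReal (q U))
    {Nb : Edge d L → Set (Edge d L)} (hΦ : ∀ e, DependsOn (fun W => Φ W e) (Nb e)) {r : ℕ}
    (hN : ∀ e, ∀ e' ∈ Nb e, dist e e' ≤ r) {acc : ℝ}
    (hacc : acc ≤ ∫ U, ∫ U', min
        (Real.exp (-(β * wilsonAction (StrongCoupling.defRep n) U)) / (partitionFn fun W :
          GaugeConfig d L (Matrix.specialUnitaryGroup (Fin n) ℂ) =>
            β * wilsonAction (StrongCoupling.defRep n) W).toReal * q U')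
        (Real.exp (-(β * wilsonAction (StrongCoupling.defRep n) U')) / (partitionFn fun W :
          GaugeConfig d L (Matrix.specialUnitaryGroup (Fin n) ℂ) =>
            β * wilsonAction (StrongCoupling.defRep n) W).toReal * q U)
        ∂(trivialMeasure (Matrix.specialUnitaryGroup (Fin n) ℂ) d L)
        ∂(trivialMeasure (Matrix.specialUnitaryGroup (Fin n) ℂ) d L))
    {p : Plaquette d L} (hp0 : p.1 0 = 0) (hi : 0 < p.2.1.1) {t : ℕ} (ht : t ≤ L) {sep : ℕ}
    (hfar : ∀ e ∈ sliceEdges d L 0, ∀ e' ∈ sliceEdges d L (t : ZMod L), sep ≤ dist e e')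
    (hacc_t : 4 * (1 - acc) * ((n : ℝ) * n)
      < sliceCov (StrongCoupling.defRep n) β
            (fun U : GaugeConfig d L (Matrix.specialUnitaryGroup (Fin n) ℂ) =>
              WilsonRP.plaqRe (StrongCoupling.defRep n) U p) 0
        * (sliceCov (StrongCoupling.defRep n) β
              (fun U : GaugeConfig d L (Matrix.specialUnitaryGroup (Fin n) ℂ) =>
                WilsonRP.plaqRe (StrongCoupling.defRep n) U p) 1
          / sliceCov (StrongCoupling.defRep n) β
              (fun U : GaugeConfig d L (Matrix.specialUnitaryGroup (Fin n) ℂ) =>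
                WilsonRP.plaqRe (StrongCoupling.defRep n) U p) 0) ^ t) :
    sep ≤ 2 * r := by
  have h2L : 2 ≤ L := by obtain ⟨r, hr⟩ := hL; have := NeZero.ne L; omega
  have hρ : Continuous (StrongCoupling.defRep n) := continuous_subtype_val
  have hv : 0 < sliceCov (StrongCoupling.defRep n) β
      (fun U : GaugeConfig d L (Matrix.specialUnitaryGroup (Fin n) ℂ) =>
        WilsonRP.plaqRe (StrongCoupling.defRep n) U p) 0 := by
    rw [sliceCov_zero]
    exact plaqRe_variance_pos h2L hn β p
  exact sep_le_two_mul_range_of_sliceCov_one hL (StrongCoupling.defRep n) hρ hβ.le dist hsymm htri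
    hΦm hq0 hqm hν hΦ hN hacc (WilsonRP.measurable_plaqRe _ hρ p)
    (fun U => WilsonRP.abs_plaqRe_le _ hρ U p) (dependsOn_plaqRe_slice _ hp0 hi.ne' (hi.trans p.2.2).ne')
    hv (plaqRe_sliceCov_one_pos hL hn hβ p hp0 hi) ht hfar hacc_t

end Gauge

end WitnessColumn

end Summit.Ventures.LatticeQCDFlow.TrivializingMaps

end
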